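import Mathlib.MeasureTheory.Integral.RieszMarkovKakutani.Real
import Mathlib.MeasureTheory.Integral.BoundedContinuousFunction
import Mathlib.MeasureTheory.Constructions.Polish.Basic
import Mathlib.Topology.MetricSpace.PiNat
import Mathlib.Topology.TietzeExtension
import HarnessLib

/-!
# Tight positive linear functionals on `C_b(X)`, `X` Polish, are finite Borel measures

A positive linear functional `L` on the bounded continuous functions `C_b(X) = X →ᵇ ℝ` of a
Polish space `X` which is **tight** — for every `ε > 0` there is a compact `K ⊆ X` with
`|L f| ≤ ε ‖f‖` for all `f ∈ C_b(X)` vanishing on `K` — is integration against a finite Borel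
measure: `L f = ∫ f dμ` for all `f ∈ C_b(X)` (`exists_measure_of_isTightFunctional`), and `μ` is a
probability measure when `L 1 = 1` (`exists_probabilityMeasure_of_isTightFunctional`).

This is the case `𝒞 = C_b⁺(X)` of the Pollard–Topsøe / Berg–Christensen–Ressel representation
theorem (Berg–Christensen–Ressel 1984, Ch. 2, Thm. 2.2: a positive additive functional on a
point-separating cone of nonnegative continuous functions satisfying the tightness condition (v)
is a Radon measure; conditions (i)–(iv) are automatic for `C_b⁺`), equivalently the tightness ⇒
Daniell-continuity ⇒ Stone–Daniell argument (Dudley 2002, proof of Thm. 9.3.3). Without tightness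
the statement fails on every non-compact `X` (Banach limits on `C_b(ℕ)`).

## Proof

Mathlib has the Riesz–Markov–Kakutani theorem for *locally compact* spaces
(`RealRMK.integral_rieszMeasure`); a Polish space (e.g. an infinite-dimensional Hilbert space)
is not locally compact, so we compactify: embed `X` topologically into the Hilbert cube
`Q = ℕ → [0,1]` (`Metric.PiNatEmbed.exists_embedding_to_hilbert_cube`), push `L` forward to a
positive functional `g ↦ L (g ∘ F)` on `C(Q) = C_c(Q)`, represent it by a finite regular measure
`μ'` on `Q` (RMK), show by tightness and Urysohn that `μ'((F K_ε)ᶜ) ≤ ε` — so `μ'` is carried by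
`range F` —, pull `μ'` back along the measurable embedding `F` (Lusin–Souslin,
`Continuous.measurableEmbedding`), and prove `∫ f dμ = L f` by approximating `f|_{K_ε}` by
`g ∘ F` with `g ∈ C(Q)`, `‖g‖ ≤ ‖f‖` (Tietze on the compact `F(K_ε)`): both sides move by at most
`2 ε ‖f‖`.

## Mathlib search

Mathlib (this pin) has RMK for locally compact `T2` spaces (`RealRMK.rieszMeasure`,
`RealRMK.integral_rieszMeasure`, `RealRMK.rieszMeasure_le_of_eq_one`), the Hilbert-cube
embedding of separable metric spaces, Lusin–Souslin, Tietze
(`BoundedContinuousFunction.exists_extension_norm_eq_of_isClosedEmbedding`) and Urysohn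
(`exists_continuousMap_one_of_isCompact_subset_isOpen`); it has no representation theorem for
functionals on `C_b` of a non-locally-compact space and no Daniell–Stone theorem (searched
`Daniell`, `tight`, `BoundedContinuousFunction` + `rieszMeasure`: nothing).

## References

* C. Berg, J. P. R. Christensen, P. Ressel, *Harmonic Analysis on Semigroups*, GTM 100,
  Springer 1984, Ch. 2 §2, Thm. 2.2 and Cor. 2.3. [BergChristensenRessel1984]
* R. M. Dudley, *Real Analysis and Probability*, CUP 2002, Thm. 4.5.2 (Stone–Daniell) and the
  proof of Thm. 9.3.3. [Dudley2002]
-/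

noncomputable section

open MeasureTheory Filter Set Function TopologicalSpace Topology BoundedContinuousFunction
open scoped ENNReal NNReal BoundedContinuousFunction CompactlySupported

namespace Literature.MeasureTheory.RieszRepresentation

variable {X : Type*} [TopologicalSpace X]

/-- A linear functional `L` on `C_b(X)` is **tight** if for every `ε > 0` there is a compact set
`K ⊆ X` such that `|L f| ≤ ε ‖f‖` for every bounded continuous `f` vanishing on `K`
(Berg–Christensen–Ressel 1984, Ch. 2 §2, condition (v) before Thm. 2.2, for the cone `C_b⁺(X)`). [cite: BergChristensenRessel1984, Ch. 2 §2, condition (v)] -/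
def IsTightFunctional (L : (X →ᵇ ℝ) →ₗ[ℝ] ℝ) : Prop :=
  ∀ ε : ℝ, 0 < ε → ∃ K : Set X, IsCompact K ∧
    ∀ f : X →ᵇ ℝ, (∀ x ∈ K, f x = 0) → |L f| ≤ ε * ‖f‖

/-! ### Pulling bounded continuous functions and positive functionals along a continuous map -/

section Pull

variable {Q : Type*} [TopologicalSpace Q] [CompactSpace Q]

/-- The bounded continuous function `g ∘ F` on `X` obtained from a continuous `g` on a compact
space `Q` and a continuous `F : X → Q`. [folklore] -/
def pull (F : C(X, Q)) (g : C(Q, ℝ)) : X →ᵇ ℝ :=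
  (BoundedContinuousFunction.mkOfCompact g).compContinuous F

/-- `pull F g x = g (F x)`. [folklore] -/
@[simp]
theorem pull_apply (F : C(X, Q)) (g : C(Q, ℝ)) (x : X) : pull F g x = g (F x) := rfl

/-- `‖pull F g‖ ≤ C` as soon as `|g| ≤ C` pointwise. [folklore] -/
theorem norm_pull_le (F : C(X, Q)) (g : C(Q, ℝ)) {C : ℝ} (hC : 0 ≤ C) (hg : ∀ y, |g y| ≤ C) :
    ‖pull F g‖ ≤ C :=
  (BoundedContinuousFunction.norm_le hC).2 fun x => by
    rw [pull_apply, Real.norm_eq_abs]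
    exact hg (F x)

/-- The push-forward of a positive linear functional `L` on `C_b(X)` along a continuous map
`F : X → Q` into a compact space: the positive linear functional `g ↦ L (g ∘ F)` on
`C_c(Q, ℝ) = C(Q, ℝ)`, in the bundled form consumed by Mathlib's Riesz–Markov–Kakutani theorem. [folklore] -/
def pullFunctional (L : (X →ᵇ ℝ) →ₗ[ℝ] ℝ) (hpos : ∀ f : X →ᵇ ℝ, (∀ x, 0 ≤ f x) → 0 ≤ L f)
    (F : C(X, Q)) : C_c(Q, ℝ) →ₚ[ℝ] ℝ :=
  PositiveLinearMap.mk₀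
    { toFun := fun g => L (pull F g.toContinuousMap)
      map_add' := fun g₁ g₂ => by
        rw [← map_add]
        exact congrArg L (BoundedContinuousFunction.ext fun x => by simp)
      map_smul' := fun c g => by
        rw [RingHom.id_apply, ← map_smul]
        exact congrArg L (BoundedContinuousFunction.ext fun x => by simp) }
    fun g hg => hpos _ fun x => by
      simpa using CompactlySupportedContinuousMap.le_def.1 hg (F x)

/-- `pullFunctional L hpos F g = L (g ∘ F)`. [folklore] -/
@[simp]
theorem pullFunctional_apply (L : (X →ᵇ ℝ) →ₗ[ℝ] ℝ)
    (hpos : ∀ f : X →ᵇ ℝ, (∀ x, 0 ≤ f x) → 0 ≤ L f) (F : C(X, Q)) (g : C_c(Q, ℝ)) :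
    pullFunctional L hpos F g = L (pull F g.toContinuousMap) := rfl

end Pull

/-! ### The representation theorem -/

/-- **Mass estimate.** Let `F : X → Q` be continuous into a compact `T₂` space, `L` a positive
functional on `C_b(X)` and `μ'` the Riesz–Markov–Kakutani measure of `g ↦ L (g ∘ F)` on `Q`. If
`|L f| ≤ ε ‖f‖` for all `f` vanishing on the compact `K ⊆ X`, then `μ'((F K)ᶜ) ≤ ε`: by inner
regularity it suffices to bound `μ'(C)` for compact `C ⊆ (F K)ᶜ`, and a Urysohn function
`g = 1` on `C` supported in `(F K)ᶜ` has `μ'(C) ≤ L (g ∘ F) ≤ ε` since `g ∘ F` vanishes on `K`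
(Berg–Christensen–Ressel 1984, Ch. 2, proof of Thm. 2.2). [cite: BergChristensenRessel1984, Ch. 2 Thm. 2.2 (proof)] -/
theorem rieszMeasure_pullFunctional_compl_image_le {Q : Type*} [TopologicalSpace Q]
    [CompactSpace Q] [T2Space Q] [MeasurableSpace Q] [BorelSpace Q]
    (L : (X →ᵇ ℝ) →ₗ[ℝ] ℝ) (hpos : ∀ f : X →ᵇ ℝ, (∀ x, 0 ≤ f x) → 0 ≤ L f) (F : C(X, Q))
    {ε : ℝ} (hε : 0 ≤ ε) {K : Set X} (hK : IsCompact K)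
    (hLK : ∀ f : X →ᵇ ℝ, (∀ x ∈ K, f x = 0) → |L f| ≤ ε * ‖f‖) :
    RealRMK.rieszMeasure (pullFunctional L hpos F) (F '' K)ᶜ ≤ ENNReal.ofReal ε := by
  set μ' := RealRMK.rieszMeasure (pullFunctional L hpos F) with hμ'
  have hU : IsOpen (F '' K)ᶜ := (hK.image F.continuous).isClosed.isOpen_compl
  by_contra h
  rw [not_le] at h
  obtain ⟨C, hCU, hC, hεC⟩ := hU.exists_lt_isCompact h
  obtain ⟨g, hg1, hgc, hgU, hg01⟩ := exists_continuousMap_one_of_isCompact_subset_isOpen hC hU hCU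
  let G : C_c(Q, ℝ) := ⟨g, hgc⟩
  have h1 : μ' C ≤ ENNReal.ofReal (pullFunctional L hpos F G) :=
    RealRMK.rieszMeasure_le_of_eq_one _ (fun y => (hg01 y).1) hC fun y hy => hg1 hy
  have h2 : pullFunctional L hpos F G ≤ ε := by
    rw [pullFunctional_apply]
    have hvan : ∀ x ∈ K, pull F G.toContinuousMap x = 0 := fun x hx => by
      rw [pull_apply]
      exact image_eq_zero_of_notMem_tsupport fun hx' => hgU hx' ⟨x, hx, rfl⟩
    have hnorm : ‖pull F G.toContinuousMap‖ ≤ 1 :=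
      norm_pull_le F _ zero_le_one fun y => by
        rw [abs_le]
        exact ⟨by linarith [(hg01 y).1], (hg01 y).2⟩
    calc L (pull F G.toContinuousMap) ≤ |L (pull F G.toContinuousMap)| := le_abs_self _
      _ ≤ ε * ‖pull F G.toContinuousMap‖ := hLK _ hvan
      _ ≤ ε * 1 := by gcongr
      _ = ε := mul_one ε
  exact absurd (hεC.trans_le (h1.trans (ENNReal.ofReal_le_ofReal h2))) (lt_irrefl _)

/-- **Tight positive functionals on `C_b` of a Polish space are finite measures**
(Berg–Christensen–Ressel 1984, Ch. 2, Thm. 2.2 with `𝒞 = C_b⁺(X)`, whose condition (v) is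
`IsTightFunctional`; cf. Dudley 2002, proof of Thm. 9.3.3). Let `X` be Polish with its Borel
σ-algebra and `L : C_b(X) → ℝ` linear, positive (`f ≥ 0 ⇒ L f ≥ 0`) and tight. Then there is a
finite Borel measure `μ` on `X` with `∫ f dμ = L f` for every `f ∈ C_b(X)`. Proof by
compactification in the Hilbert cube, Riesz–Markov–Kakutani there, and pull-back along the
(Lusin–Souslin measurable) embedding; see the module docstring. [cite: BergChristensenRessel1984, Ch. 2 Thm. 2.2] -/
theorem exists_measure_of_isTightFunctional [PolishSpace X] [MeasurableSpace X] [BorelSpace X]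
    (L : (X →ᵇ ℝ) →ₗ[ℝ] ℝ) (hpos : ∀ f : X →ᵇ ℝ, (∀ x, 0 ≤ f x) → 0 ≤ L f)
    (htight : IsTightFunctional L) :
    ∃ μ : Measure X, IsFiniteMeasure μ ∧ ∀ f : X →ᵇ ℝ, ∫ x, f x ∂μ = L f := by
  letI := upgradeIsCompletelyMetrizable X
  -- Step 1: a topological embedding into the Hilbert cube, measurable by Lusin–Souslin
  obtain ⟨F, hF⟩ := Metric.PiNatEmbed.exists_embedding_to_hilbert_cube (X := X)
  have hFc : Continuous F := hF.continuous
  have hFi : Injective F := hF.injective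
  set Fc : C(X, ℕ → unitInterval) := ⟨F, hFc⟩
  have hFm : MeasurableEmbedding F := hFc.measurableEmbedding hFi
  -- Step 2: Riesz–Markov–Kakutani on the cube for `g ↦ L (g ∘ F)`
  set Λ' : C_c(ℕ → unitInterval, ℝ) →ₚ[ℝ] ℝ := pullFunctional L hpos Fc with hΛ'
  set μ' : Measure (ℕ → unitInterval) := RealRMK.rieszMeasure Λ' with hμ'def
  have hint' : ∀ g : C_c(ℕ → unitInterval, ℝ),
      ∫ y, g y ∂μ' = L (pull Fc g.toContinuousMap) := fun g =>
    RealRMK.integral_rieszMeasure Λ' g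
  -- Step 3: tightness ⇒ `μ'` is carried by `range F`
  have hmass : ∀ {ε : ℝ}, 0 ≤ ε → ∀ {K : Set X}, IsCompact K →
      (∀ f : X →ᵇ ℝ, (∀ x ∈ K, f x = 0) → |L f| ≤ ε * ‖f‖) →
        μ' (F '' K)ᶜ ≤ ENNReal.ofReal ε := fun hε K hK hLK =>
    rieszMeasure_pullFunctional_compl_image_le L hpos Fc hε hK hLK
  have hrange : μ' (range F)ᶜ = 0 := by
    refine le_antisymm (ENNReal.le_of_forall_pos_le_add fun ε hε _ => ?_) bot_le
    obtain ⟨K, hK, hLK⟩ := htight ε (by exact_mod_cast hε)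
    calc μ' (range F)ᶜ ≤ μ' (F '' K)ᶜ :=
          measure_mono (compl_subset_compl.2 (image_subset_range _ _))
      _ ≤ ENNReal.ofReal (ε : ℝ) := hmass (by exact_mod_cast hε.le) hK hLK
      _ = 0 + ε := by rw [ENNReal.ofReal_coe_nnreal, zero_add]
  -- Step 4: pull `μ'` back to `X`
  set μ : Measure X := Measure.comap F μ' with hμdef
  have hmap : Measure.map F μ = μ' := by
    rw [hμdef, hFm.map_comap, Measure.restrict_eq_self_of_ae_mem]
    exact (measure_eq_zero_iff_ae_notMem.1 hrange).mono fun y hy => not_notMem.1 hy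
  haveI hfin : IsFiniteMeasure μ :=
    ⟨by rw [hμdef, hFm.comap_apply]; exact measure_lt_top μ' _⟩
  have htransfer : ∀ g : (ℕ → unitInterval) → ℝ, ∫ x, g (F x) ∂μ = ∫ y, g y ∂μ' := fun g => by
    rw [← hFm.integral_map, hmap]
  have hcompl : ∀ K : Set X, μ Kᶜ ≤ μ' (F '' K)ᶜ := fun K => by
    rw [hμdef, hFm.comap_apply]
    exact measure_mono (image_compl_subset hFi)
  -- Step 5: the representation, up to `4 ε ‖f‖` for every `ε`
  refine ⟨μ, hfin, fun f => eq_of_forall_dist_le fun δ hδ => ?_⟩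
  set ε : ℝ := δ / (4 * (‖f‖ + 1)) with hεdef
  have hf1 : 0 < ‖f‖ + 1 := by positivity
  have hε : 0 < ε := by positivity
  obtain ⟨K, hK, hLK⟩ := htight ε hε
  haveI : CompactSpace K := isCompact_iff_compactSpace.1 hK
  -- Tietze: extend `f|_K`, transported to the compact `F(K)`, to `g ∈ C(cube)` with `‖g‖ ≤ ‖f‖`
  have he : IsClosedEmbedding (fun x : K => F x) :=
    (hFc.comp continuous_subtype_val).isClosedEmbedding (hFi.comp Subtype.val_injective)
  obtain ⟨g, hgn, hge⟩ := (f.restrict K).exists_extension_norm_eq_of_isClosedEmbedding he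
  have hgf : ‖g‖ ≤ ‖f‖ := by
    rw [hgn]
    exact (BoundedContinuousFunction.norm_le (norm_nonneg f)).2 fun x => f.norm_coe_le_norm x
  set h : X →ᵇ ℝ := pull Fc g.toContinuousMap with hhdef
  have hh_apply : ∀ x, h x = g (F x) := fun x => rfl
  have hfh : ∀ x ∈ K, (f - h) x = 0 := fun x hx => by
    have hx' := congr_fun hge ⟨x, hx⟩
    simp only [Function.comp_apply] at hx'
    rw [BoundedContinuousFunction.sub_apply, hh_apply, hx', sub_eq_zero]
    rfl
  have hfh_norm : ‖f - h‖ ≤ 2 * ‖f‖ := by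
    have hh : ‖h‖ ≤ ‖f‖ := norm_pull_le Fc _ (norm_nonneg f) fun y =>
      (Real.norm_eq_abs _ ▸ g.norm_coe_le_norm y).trans hgf
    calc ‖f - h‖ ≤ ‖f‖ + ‖h‖ := norm_sub_le f h
      _ ≤ ‖f‖ + ‖f‖ := by gcongr
      _ = 2 * ‖f‖ := by ring
  -- the functional side moves by at most `2 ε ‖f‖`
  have hLside : |L f - L h| ≤ ε * (2 * ‖f‖) := by
    rw [← map_sub]
    exact (hLK (f - h) hfh).trans (by gcongr)
  -- `L h` is an honest integral
  have hLh : L h = ∫ x, h x ∂μ := by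
    have h1 : L h = ∫ y, g y ∂μ' :=
      (hint' (CompactlySupportedContinuousMap.continuousMapEquiv g.toContinuousMap)).symm
    rw [h1, ← htransfer]
    rfl
  -- the integral side moves by at most `2 ε ‖f‖`
  have hμK : μ.real Kᶜ ≤ ε := by
    rw [measureReal_def]
    exact ENNReal.toReal_le_of_le_ofReal hε.le ((hcompl K).trans (hmass hε.le hK hLK))
  have hIside : |∫ x, f x ∂μ - ∫ x, h x ∂μ| ≤ ε * (2 * ‖f‖) := by
    rw [← integral_sub (f.integrable μ) (h.integrable μ)]
    have hbound : ∀ x, ‖(f - h) x‖ ≤ Kᶜ.indicator (fun _ => 2 * ‖f‖) x := fun x => by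
      by_cases hx : x ∈ K
      · rw [hfh x hx, norm_zero, indicator_of_notMem (notMem_compl_iff.2 hx)]
      · rw [indicator_of_mem (mem_compl hx)]
        exact ((f - h).norm_coe_le_norm x).trans hfh_norm
    have hKm : MeasurableSet Kᶜ := hK.isClosed.measurableSet.compl
    calc |∫ x, (f - h) x ∂μ| = ‖∫ x, (f - h) x ∂μ‖ := (Real.norm_eq_abs _).symm
      _ ≤ ∫ x, Kᶜ.indicator (fun _ => 2 * ‖f‖) x ∂μ :=
          norm_integral_le_of_norm_le ((integrable_const _).indicator hKm)
            (ae_of_all _ fun x => by simpa only [BoundedContinuousFunction.coe_sub] using hbound x)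
      _ = μ.real Kᶜ * (2 * ‖f‖) := by rw [integral_indicator_const _ hKm, smul_eq_mul]
      _ ≤ ε * (2 * ‖f‖) := by gcongr
  -- conclusion
  calc dist (∫ x, f x ∂μ) (L f) = |(∫ x, f x ∂μ - ∫ x, h x ∂μ) - (L f - L h)| := by
        rw [Real.dist_eq, hLh]; ring_nf
    _ ≤ |∫ x, f x ∂μ - ∫ x, h x ∂μ| + |L f - L h| := abs_sub _ _
    _ ≤ ε * (2 * ‖f‖) + ε * (2 * ‖f‖) := add_le_add hIside hLside
    _ = δ * (‖f‖ / (‖f‖ + 1)) := by rw [hεdef]; field_simp; ring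
    _ ≤ δ * 1 := by gcongr; exact (div_le_one hf1).2 (by linarith)
    _ = δ := mul_one δ

/-- **Normalised form**: a tight positive linear functional `L` on `C_b(X)`, `X` Polish, with
`L 1 = 1` is the expectation of a Borel probability measure: `∫ f dμ = L f` for all `f ∈ C_b(X)`
(Berg–Christensen–Ressel 1984, Ch. 2, Thm. 2.2; the normalisation `μ(X) = L 1 = 1`). [cite: BergChristensenRessel1984, Ch. 2 Thm. 2.2] -/
theorem exists_probabilityMeasure_of_isTightFunctional [PolishSpace X] [MeasurableSpace X]
    [BorelSpace X] (L : (X →ᵇ ℝ) →ₗ[ℝ] ℝ) (hpos : ∀ f : X →ᵇ ℝ, (∀ x, 0 ≤ f x) → 0 ≤ L f)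
    (htight : IsTightFunctional L) (hone : L 1 = 1) :
    ∃ μ : Measure X, IsProbabilityMeasure μ ∧ ∀ f : X →ᵇ ℝ, ∫ x, f x ∂μ = L f := by
  obtain ⟨μ, hfin, hμ⟩ := exists_measure_of_isTightFunctional L hpos htight
  refine ⟨μ, ⟨?_⟩, hμ⟩
  have h := hμ 1
  rw [hone] at h
  simp only [BoundedContinuousFunction.coe_one, Pi.one_apply, integral_const, smul_eq_mul,
    mul_one] at h
  rwa [measureReal_def, ENNReal.toReal_eq_one_iff] at h

end Literature.MeasureTheory.RieszRepresentation
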